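import Mathlib
import Summits.KontsevichZagierPeriods.KontsevichZagierPeriods.Theorems.FermatIsogenyBetaLinearSectorQuartersStubBetaDuplication
import HarnessLib

/-!
# `BetaLinearSector` (stmt-KontsevichZagierPeriods-3897), line `fermat-sector-transport` —
# stub `stub_betaHalfSum_duplication` (the half-sum duplication `B(a,½-a) = 2^{1-2a}·B(2a,½-a)`)

The LEVEL-6 rung (`a, b, a', b' ∈ ⅙ℤ`) of the crux `BetaLinearSector` (route FermatIsogeny) needs
the two intra-class coincidences `B(1/6,1/3) = 2^{2/3}·B(1/3,1/3)` and
`B(1/3,1/6) = 2^{1/3}·B(2/3,1/6)`, both instances of the HALF-SUM DUPLICATION: for `a + b = 1/2`,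
`B(a,b) = 2^{1-2a} · B(2a,b)`.  THIS file realises it INSIDE the Kontsevich–Zagier calculus of
moves by ONE rational change of variables (rule (2) of [Kontsevich–Zagier 2001, §1.2]):

* source `d = [(0,1), 2^{1-2a} · s^{2a-1} (1-s)^{-a-1/2}]` (value `2^{1-2a}·B(2a, 1/2-a)`);
* map `x = Φ(s) = s²/(2-s)² = (s/(2-s))²` from `(0,1)` onto `(0,1)` (`ℚ`-rational, denominator
  `(2-s)² ≠ 0` on `(0,1)`, `Φ' = 4s/(2-s)³ > 0`, `Φ(0) = 0`, `Φ(1) = 1`; the inverse branch is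
  `s = 2√x/(1+√x)`);
* target `r = [(0,1), x^{a-1} (1-x)^{-a-1/2}]` (value `B(a, 1/2-a)`).

Pull-back check (`halfSum_pullback`): `1 - Φ(s) = 4(1-s)/(2-s)²`, so
`Φ^{a-1} = s^{2a-2} (2-s)^{2-2a}`, `(1-Φ)^{-a-1/2} = 4^{-a-1/2} (1-s)^{-a-1/2} (2-s)^{2a+1}`, and
`r.integrand (Φ s) · |Φ' s| = 4^{1/2-a} · s^{2a-1} (1-s)^{-a-1/2} · (2-s)^{(2-2a)+(2a+1)-3}
= 2^{1-2a} · s^{2a-1} (1-s)^{-a-1/2}`, the integrand of `d` — the power of `2-s` vanishes exactly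
because the two Beta parameters sum to `1/2`.  Both representations are given (pinned by domain
and integrand); only the relation `[d] − [r] ∈ KZ.relations` is produced, through the
one-dimensional packaging `of_sub_of_mem_changeOfVariablesRel_dimOne` of rule (2) (same
architecture as `Quarters.stub_betaFold_duplication` and
`GKZLevelThree.cubicRational_equivalent_beta`); the stub returns the symmetric relation `r ∼ d`.

References: M. Kontsevich, D. Zagier, *Periods* (2001), §1.2 rule (2); G. E. Andrews, R. Askey,
R. Roy, *Special Functions* (1999), §1.5 (Legendre's duplication formula).
-/

noncomputable section

namespace Summit.KontsevichZagierPeriods.FermatIsogeny.BetaLinearSector.Sixths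

open Set MeasureTheory
open MvPolynomial (aeval X C)
open Literature.NumberTheory.Transcendental Literature.NumberTheory.Transcendental.KZ
open Summit.KontsevichZagierPeriods.HermiteRigidity.CMTwistQuasiPeriodTransfer
  (of_sub_of_mem_changeOfVariablesRel_dimOne)
open Summit.KontsevichZagierPeriods.KontsevichZagierPeriods.Theorems.GKZLevelThree
  (isSemialgebraicFunOn_ratFun₁)

/-! ## The substitution `x = s²/(2-s)²` on `(0, 1)` -/

/-- The derivative of `Φ(s) = s²/(2-s)²` is `4s/(2-s)³` (for `s < 2`). -/
theorem halfSum_hasDerivAt {s : ℝ} (hs : s < 2) :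
    HasDerivAt (fun s : ℝ => s ^ 2 / (2 - s) ^ 2) (4 * s / (2 - s) ^ 3) s := by
  have hq : (2 - s) ≠ 0 := (sub_pos.2 hs).ne'
  have h1 : HasDerivAt (fun s : ℝ => s ^ 2) (2 * s) s := by
    simpa using hasDerivAt_pow 2 s
  have h2 : HasDerivAt (fun s : ℝ => (2 - s) ^ 2) (-(2 * (2 - s))) s := by
    simpa using ((hasDerivAt_id s).const_sub (2:ℝ)).fun_pow 2
  exact (h1.div h2 (pow_ne_zero 2 hq)).congr_deriv (by field_simp; ring)

/-- `1 - s²/(2-s)² = 4(1-s)/(2-s)²` (for `s < 2`). -/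
theorem halfSum_one_sub {s : ℝ} (hs : s < 2) :
    1 - s ^ 2 / (2 - s) ^ 2 = 4 * (1 - s) / (2 - s) ^ 2 := by
  have hq : (2 - s) ≠ 0 := (sub_pos.2 hs).ne'
  field_simp
  ring

/-- `Φ = s²/(2-s)²` is injective on `(0, 2)`: there `Φ p = Φ q` forces `p(2-q) = q(2-p)`. -/
theorem halfSum_inj {p q : ℝ} (hp0 : 0 < p) (hp2 : p < 2) (hq0 : 0 < q) (hq2 : q < 2)
    (h : p ^ 2 / (2 - p) ^ 2 = q ^ 2 / (2 - q) ^ 2) : p = q := by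
  have hp' : 0 < 2 - p := by linarith
  have hq' : 0 < 2 - q := by linarith
  rw [div_eq_div_iff (pow_ne_zero 2 hp'.ne') (pow_ne_zero 2 hq'.ne')] at h
  have h1 : (p * (2 - q) - q * (2 - p)) * (p * (2 - q) + q * (2 - p)) = 0 := by
    linear_combination h
  rcases mul_eq_zero.1 h1 with h2 | h2
  · linear_combination h2 / 2
  · nlinarith [mul_pos hp0 hq', mul_pos hq0 hp']

/-- `Φ` maps `(0, 1)` into `(0, 1)` (`s² < (2-s)²` iff `s < 1`). -/
theorem halfSum_mem_Ioo {s : ℝ} (h0 : 0 < s) (h1 : s < 1) :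
    s ^ 2 / (2 - s) ^ 2 ∈ Ioo (0:ℝ) 1 := by
  have h2 : 0 < 2 - s := by linarith
  refine ⟨by positivity, ?_⟩
  rw [div_lt_one (by positivity)]
  nlinarith

/-- `Φ` maps `(0, 1)` ONTO `(0, 1)`: `x ∈ (0,1)` is `Φ(2t/(1+t))` with `t = √x`. -/
theorem halfSum_image :
    (fun s : ℝ => s ^ 2 / (2 - s) ^ 2) '' Ioo (0:ℝ) 1 = Ioo 0 1 := by
  apply Subset.antisymm
  · rintro _ ⟨s, hs, rfl⟩
    exact halfSum_mem_Ioo hs.1 hs.2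
  · intro x hx
    obtain ⟨t, ht0, ht1, htsq⟩ : ∃ t : ℝ, 0 < t ∧ t < 1 ∧ t ^ 2 = x :=
      ⟨Real.sqrt x, Real.sqrt_pos.2 hx.1, by rw [Real.sqrt_lt' one_pos]; linarith [hx.2],
        Real.sq_sqrt hx.1.le⟩
    have h1t : (1 + t) ≠ 0 := by positivity
    have hden : 2 - 2 * t / (1 + t) = 2 / (1 + t) := by
      field_simp
      ring
    refine ⟨2 * t / (1 + t), ⟨by positivity, ?_⟩, ?_⟩
    · rw [div_lt_one (by positivity)]
      linarith
    · show (2 * t / (1 + t)) ^ 2 / (2 - 2 * t / (1 + t)) ^ 2 = x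
      rw [hden, ← htsq]
      field_simp

/-! ## The pull-back identity -/

/-- The constant bookkeeping of the half-sum duplication: `2^{1-2a} = 4^{-a-1/2} · 4`. -/
theorem halfSum_const (a : ℝ) : (2:ℝ) ^ (1 - 2 * a) = (4:ℝ) ^ (-a - 1 / 2) * 4 := by
  rw [← Real.rpow_add_one (by norm_num : (4:ℝ) ≠ 0),
    show (4:ℝ) = (2:ℝ) ^ (2:ℝ) by rw [Real.rpow_two]; norm_num, ← Real.rpow_mul zero_le_two]
  congr 1
  ring

/-- The pull-back identity: for `0 < s < 1` and `x = s²/(2-s)²`,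
`x^{a-1} (1-x)^{-a-1/2} · |4s/(2-s)³| = 2^{1-2a} · (s^{2a-1} (1-s)^{-a-1/2})`. -/
theorem halfSum_pullback {a s : ℝ} (hs0 : 0 < s) (hs1 : s < 1) :
    (s ^ 2 / (2 - s) ^ 2) ^ (a - 1) * (1 - s ^ 2 / (2 - s) ^ 2) ^ (-a - 1 / 2) *
        |4 * s / (2 - s) ^ 3| =
      (2:ℝ) ^ (1 - 2 * a) * (s ^ (2 * a - 1) * (1 - s) ^ (-a - 1 / 2)) := by
  have hs2 : s < 2 := by linarith
  have hq : 0 < 2 - s := by linarith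
  have hq' : (2 - s) ≠ 0 := hq.ne'
  have h1s : 0 < 1 - s := by linarith
  -- `Φ^{a-1} = s^{2a-2} / (2-s)^{2a-2}`
  have hA : (s ^ 2 / (2 - s) ^ 2) ^ (a - 1) = s ^ (2 * a - 2) / (2 - s) ^ (2 * a - 2) := by
    rw [Real.div_rpow (by positivity) (by positivity), ← Real.rpow_two s, ← Real.rpow_two (2 - s),
      ← Real.rpow_mul hs0.le, ← Real.rpow_mul hq.le, show (2:ℝ) * (a - 1) = 2 * a - 2 by ring]
  -- `(2-s)^3` as a real power
  have h3 : (2 - s) ^ (3:ℝ) = (2 - s) ^ (3:ℕ) := by exact_mod_cast Real.rpow_natCast (2 - s) 3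
  -- `(1-Φ)^{-a-1/2} = 4^{-a-1/2} (1-s)^{-a-1/2} · ((2-s)^{2a-2} (2-s)³)`
  have hB : (1 - s ^ 2 / (2 - s) ^ 2) ^ (-a - 1 / 2) =
      (4:ℝ) ^ (-a - 1 / 2) * (1 - s) ^ (-a - 1 / 2) * ((2 - s) ^ (2 * a - 2) * (2 - s) ^ 3) := by
    rw [halfSum_one_sub hs2, Real.div_rpow (by positivity) (by positivity),
      Real.mul_rpow (by norm_num) h1s.le, ← Real.rpow_two (2 - s), ← Real.rpow_mul hq.le,
      show (2:ℝ) * (-a - 1 / 2) = -((2 * a - 2) + 3) by ring, Real.rpow_neg hq.le,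
      Real.rpow_add hq, div_inv_eq_mul, h3]
  -- `s^{2a-1} = s^{2a-2} · s`
  have hX : s ^ (2 * a - 1) = s ^ (2 * a - 2) * s := by
    rw [← Real.rpow_add_one hs0.ne', show 2 * a - 2 + 1 = 2 * a - 1 by ring]
  have hP : (2 - s) ^ (2 * a - 2) ≠ 0 := (Real.rpow_pos_of_pos hq _).ne'
  rw [hA, hB, abs_of_pos (by positivity : (0:ℝ) < 4 * s / (2 - s) ^ 3), hX, halfSum_const a]
  set e : ℝ := -a - 1 / 2
  set P : ℝ := (2 - s) ^ (2 * a - 2)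
  set u : ℝ := s ^ (2 * a - 2)
  field_simp

/-! ## The half-sum duplication as ONE change of variables -/

/-- **Half-sum duplication as ONE change of variables.** For rational `0 < a < 1/2`,
`[(0,1), x^{a-1}(1-x)^{-a-1/2}] ∼ [(0,1), 2^{1-2a}·s^{2a-1}(1-s)^{-a-1/2}]`, i.e.
`B(a, 1/2-a) = 2^{1-2a}·B(2a, 1/2-a)` inside the Kontsevich–Zagier calculus, by rule (2) along
`x = s²/(2-s)²`: `ℚ`-rational on `(0,1)` (denominator `(2-s)² ≠ 0`), injective with image `(0,1)`,
derivative `4s/(2-s)³`, and the pull-back identity `halfSum_pullback`; the move gives `d ∼ r`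
and the stub returns its symmetric. [cite: KontsevichZagier2001, §1.2 rule (2)] -/
theorem stub_betaHalfSum_duplication : ∀ a : ℚ, 0 < a → a < 1 / 2 → ∀ (r d : KZ.IntegralRep 1),
    r.domain = {x | x 0 ∈ Set.Ioo (0:ℝ) 1} →
    Set.EqOn r.integrand (fun x => (x 0) ^ ((a:ℝ) - 1) * (1 - x 0) ^ (-(a:ℝ) - 1 / 2)) r.domain →
    d.domain = {x | x 0 ∈ Set.Ioo (0:ℝ) 1} →
    Set.EqOn d.integrand
      (fun x => (2:ℝ) ^ (1 - 2 * (a:ℝ)) * ((x 0) ^ (2 * (a:ℝ) - 1) * (1 - x 0) ^ (-(a:ℝ) - 1 / 2)))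
      d.domain →
    KZ.Equivalent r d := by
  intro a _ _ r d hrd hri hdd hdi
  set φ : ℝ → ℝ := fun s => s ^ 2 / (2 - s) ^ 2 with hφ
  set φ' : ℝ → ℝ := fun s => 4 * s / (2 - s) ^ 3 with hφ'
  refine Equivalent.symm (changeOfVariablesRel_subset_relations
    (of_sub_of_mem_changeOfVariablesRel_dimOne d r φ φ' ?_ ?_ ?_ ?_ ?_))
  · -- `Φ` is `ℚ`-rational with non-vanishing denominator on the domain, hence `ℚ`-semialgebraic
    refine isSemialgebraicFunOn_ratFun₁ d.isSemialgebraic_domain (X 0 ^ 2) ((C 2 - X 0) ^ 2) φ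
      (fun x hx => ?_) (fun x _ => ?_)
    · have hx' : x 0 ∈ Ioo (0:ℝ) 1 := by rw [hdd] at hx; exact hx
      have h2 : (0:ℝ) < 2 - x 0 := by linarith [hx'.2]
      simp only [map_pow, map_sub, MvPolynomial.aeval_C, MvPolynomial.aeval_X, eq_ratCast,
        Rat.cast_ofNat]
      exact pow_ne_zero 2 h2.ne'
    · simp [hφ]
  · -- the derivative along the domain
    intro p hp
    have hp' : p 0 ∈ Ioo (0:ℝ) 1 := by rw [hdd] at hp; exact hp
    exact halfSum_hasDerivAt (by linarith [hp'.2])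
  · -- injectivity on `(0, 1)`
    intro p hp q hq hpq
    rw [hdd] at hp hq
    exact halfSum_inj hp.1 (by linarith [hp.2]) hq.1 (by linarith [hq.2]) hpq
  · -- the image is `(0, 1)`
    rw [hrd, hdd]
    ext y
    simp only [mem_setOf_eq, mem_image]
    constructor
    · intro hy
      have : y 0 ∈ φ '' Ioo (0:ℝ) 1 := by rw [halfSum_image]; exact hy
      obtain ⟨w, hw, hwy⟩ := this
      exact ⟨fun _ => w, hw, funext fun i => by rw [Subsingleton.elim i 0]; exact hwy⟩
    · rintro ⟨p, hp, rfl⟩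
      exact halfSum_mem_Ioo hp.1 hp.2
  · -- the pull-back identity on the domain
    intro p hp
    have hp' : p 0 ∈ Ioo (0:ℝ) 1 := by rw [hdd] at hp; exact hp
    have hφp : (fun _ : Fin 1 => φ (p 0)) ∈ r.domain := by
      rw [hrd]
      exact halfSum_mem_Ioo hp'.1 hp'.2
    rw [hdi hp, hri hφp]
    exact (halfSum_pullback hp'.1 hp'.2).symm

end Summit.KontsevichZagierPeriods.FermatIsogeny.BetaLinearSector.Sixths

end
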